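import Summits.QuantumFields.YangMills.Theorems.SmallFieldWideningLargeFieldMassRefinementTailPerFamilyUnitTop

/-!
# Route `SmallFieldWidening`, crux r3 `LargeFieldMassRefinementTail` (stmt-QuantumFields-22884), line `birth` — THE WEAKEST REGISTERED STUB:
# r3 from SUMMABLE per-family unit-top first-exit profiles (skeleton v7 of lead `ym-line-sfw-p2` gen 25; the crux and rung R3 stay OPEN)

WHAT THIS IS NOT.  No probability estimate of Bałaban's programme is proved here; nothing bears on the Yang–Mills mass gap; rung R3
(`YM3TorusSU2`) is a RECORD rung, not the Clay statement.  This file is quantifier and series bookkeeping over LANDED tree facts.  It states and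
proves sufficient the weakest condition for crux r3 on record, which the lead registers as the ONE stub of skeleton v7 (`stub_unitTopSummable`);
the companion file shows that every earlier registered stub / certificate hypothesis of the line implies it.

THE POINT.  The v6 stub `stub_firstExitDeep` (shared verbatim with crux `FirstExitWindowTailL`, stmt-QuantumFields-26243) — equivalently its unit-top
normal form `UnitTop` (`LargeFieldMassRefinementTailUnitTop.deepStub_iff_unitTop`) — asks for the Gaussian-shaped bound `C·γ^{-N}·exp(−c·p_{b₀}(√γ)²)` on the
unit-top first-exit events with constants UNIFORM in the family (all volumes) and in `γ ≤ γ₁`; the width seat's per-family forms (`…PerFamily`,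
`…PerFamilyUnitTop`: `FirstExitFam`, `UnitTopFam`) still ask for the Gaussian SHAPE in the profile's own `p_{b₀}`.  Crux r3 needs neither.  Reading the
first-exit engine of `LargeFieldMassRefinementTailOfFirstExit` (`refine_real_compl_histGood_le`: run `K` of `F.refine d` at `γL^{-d}` is run `K + d` of `F`
with `d` free top steps, decomposed by the least bad height) with an ARBITRARY finest-bad-level profile shows that r3 follows from

  `UnitTopSummable` := ∀ L, ∃ b₀ p₀ γ₁ (0 < b₀, 2 < p₀, 0 < γ₁ ≤ 1), ∀ F (F.L = L), ∀ γ ∈ (0, γ₁], ∃ q : ℕ → ℝ, q ≥ 0, Σ_d (L^d)³·q d < ∞,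
      ∀ d, ∀ K ≥ 2, ∀ unit plaquette p of run K of `F.refine d`:
        Gibbs^{F.refine d}_{K, γL^{-d}} { every sub-unit block field Ū^k (k < K) is θ_{b₀}(K−k)-small ∧ θ_{b₀}(0) ≤ |Ū^K(∂p) − 1| } ≤ q d

— «for each family and each small coupling separately, the unit-top first-exit probabilities of the refinements `F.refine d`, UNIFORMLY IN THE RUN LENGTH
`K ≥ 2`, are summable against the unit volume `(L^d)³`» (§2, ★ `largeFieldMassRefinementTail_of_unitTopSummable`).  The profile `q`, the constants and the
profile `(b₀, p₀, γ₁)` are the supplier's; no rate is prescribed.  In «sigma» units (natural scale `√(γL^{-d})` of the fully averaged plaquette, threshold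
`t_d = b₀(1 + ½log(L^d/γ))^{p₀}` sigmas) a STRETCHED-EXPONENTIAL moderate-deviation tail `exp(−b·t^α)` with ANY exponent `α > 0` qualifies (choose
`p₀ > 1/α`), while a fixed polynomial moment bound `t^{-q}` never does (`(log L^d)^{-p₀q}` against `L^{-3d}`); what carries ALL the difficulty is the
uniformity in `K` — the ultraviolet stability of the unit-lattice block-averaged plaquette law, i.e. the small-field half of [Balaban1985UV3]/[Balaban1987RG1].

RESULTS.
* §1 `finestBad_subset_iUnion_noWindow`, `real_finestBad_le_card_mul_noWindow` — the window-free union bound over the exit plaquette (no window needed: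
  «`Ū^j` not `θ`-small» means some plaquette is `≥ θ`).
* §2 ★ `largeFieldMassRefinementTail_of_unitTopSummable : UnitTopSummable → LargeFieldMassRefinementTail` — with the landed bare profile
  (`T3BareTailProfile.bareTailAt`), first averaged level (`FirstExitWindow.stub_firstExitOne`) and window (`firstExitWindow_oneStepWindowL_proof`)
  supplying the heights `j ≤ 1`, all run on the ONE family `F.refine n₀` at `γL^{-n₀} ≤ γ₁`.
* (companion file `…OfSummableUnitTopImplications`) every earlier hypothesis of the line implies `UnitTopSummable`: `unitTopSummable_of_unitTopFam` (the
  width seat's per-family Gaussian form), `…_of_unitTop` (the uniform normal form), `…_of_deepStub` (the v6 / 26243 stub text), `…_of_firstExitWindowTailL`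
  (crux 26243 BY NAME) — so a landing of 26243's stub still closes r3 in one line through skeleton v7.

References: T. Bałaban, Commun. Math. Phys. **102** (1985) 255–275 [Balaban1985UV3] ((1)–(3) p.256, (7) p.257, (70)–(71) p.273); CMP **109** (1987) 249–301
[Balaban1987RG1] ((0.11) p.253); J. Fröhlich, R. Israel, E. Lieb, B. Simon, CMP **62** (1978) 1–34 [FrohlichIsraelLiebSimon1978] (the bare term).
-/

noncomputable section

open MeasureTheory Filter Topology
open Literature.MathematicalPhysics.QuantumFieldTheory.Balaban1983to89
open Literature.MathematicalPhysics.QuantumFieldTheory.Balaban1983to89.Missing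
open Literature.MathematicalPhysics.QuantumFieldTheory.Balaban1983to89.T3ContinuumYM3Torus
open Literature.MathematicalPhysics.QuantumFieldTheory.Balaban1983to89.T3UnitScaleTilt
open Literature.MathematicalPhysics.QuantumFieldTheory.Balaban1983to89.T3UnitLawDensityEML (ℰp measurableE_ℰp)
open Literature.MathematicalPhysics.QuantumFieldTheory.Balaban1983to89.T3LevelShift
open Literature.MathematicalPhysics.QuantumFieldTheory.Balaban1983to89.T3BareTailProfile
open Summit.QuantumFields.YangMills.Theorems.HistoryTailOfTwoSided (card_plaq_le_pow exists_perHeight_bound geometric_profile)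
open Summit.QuantumFields.YangMills.Theorems.LargeFieldMassRefinementTailOfHeightTail (refine_refine)
open Summit.QuantumFields.YangMills.Theorems.LargeFieldMassRefinementTailOfFirstExit
  (real_finestBad_le_card_mul refine_real_compl_histGood_le)
open Summit.QuantumFields.YangMills.Theorems.LargeFieldMassRefinementTailUnitTop
  (gibbsK_real_firstExit_eq_refine deepStub_iff_unitTop)
open Summit.QuantumFields.YangMills.Theorems.FirstExitWindow (tail_bound_mono one_le_inv_coupling)

namespace Summit.QuantumFields.YangMills.Theorems.LargeFieldMassRefinementTailOfSummableUnitTop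

/-! ## §1 The window-free union bound over the exit plaquette -/

section Union

variable (F : T3Family) (θ : ℕ → ℝ)

/-- **FINEST BAD LEVEL ⇒ WINDOW-FREE FIRST EXIT AT SOME PLAQUETTE**: a configuration whose level-`j` block field is NOT `θ(K−j)`-small while
all finer block fields `Ū^i`, `i < j`, are `θ(K−i)`-small lies, for some level-`j` plaquette `p`, in the window-free first-exit event «small history ∧
`θ(K−j) ≤ |Ū^j(∂p) − 1|» (`PlaqSmall` is the strict bound at every plaquette). [cite: Balaban1985UV3, (7) p.257] -/
theorem finestBad_subset_iUnion_noWindow (K j : ℕ) :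
    ({U : GaugeField (F.P K) 0 (Matrix.specialUnitaryGroup (Fin 2) ℂ) |
        ¬ PlaqSmall (θ (K - j)) (Averaging.iter (fun i => BlockAveraging.blockAvg (P := F.P K) (j := i) ℰp) j U)} ∩
      {U | ∀ i, i < j → PlaqSmall (θ (K - i))
          (Averaging.iter (fun i' => BlockAveraging.blockAvg (P := F.P K) (j := i') ℰp) i U)}) ⊆
      ⋃ p : Plaq (F.P K) j,
        {U | (∀ k, k < j → PlaqSmall (θ (K - k))
            (Averaging.iter (fun i => BlockAveraging.blockAvg (P := F.P K) (j := i) ℰp) k U)) ∧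
          θ (K - j) ≤ GaugeGroup.dist1 (GaugeField.plaqHol
            (Averaging.iter (fun i => BlockAveraging.blockAvg (P := F.P K) (j := i) ℰp) j U) p)} := by
  rintro U ⟨hbad, hhist⟩
  simp only [PlaqSmall, not_forall, not_lt, Set.mem_setOf_eq] at hbad
  obtain ⟨p, hp⟩ := hbad
  exact Set.mem_iUnion.mpr ⟨p, hhist, hp⟩

/-- **THE WINDOW-FREE UNION BOUND OVER THE EXIT PLAQUETTE**: for a finite measure `μ`, the mass of the finest-bad-level event at level `j` is at most
`#Plaq_j · B` whenever every window-free first-exit event of a level-`j` plaquette has mass `≤ B`. [cite: Balaban1985UV3, (7) p.257] -/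
theorem real_finestBad_le_card_mul_noWindow (K j : ℕ)
    (μ : Measure (GaugeField (F.P K) 0 (Matrix.specialUnitaryGroup (Fin 2) ℂ))) [IsFiniteMeasure μ] {B : ℝ}
    (hFE : ∀ p : Plaq (F.P K) j, μ.real
      {U | (∀ k, k < j → PlaqSmall (θ (K - k))
          (Averaging.iter (fun i => BlockAveraging.blockAvg (P := F.P K) (j := i) ℰp) k U)) ∧
        θ (K - j) ≤ GaugeGroup.dist1 (GaugeField.plaqHol
          (Averaging.iter (fun i => BlockAveraging.blockAvg (P := F.P K) (j := i) ℰp) j U) p)} ≤ B) :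
    μ.real ({U : GaugeField (F.P K) 0 (Matrix.specialUnitaryGroup (Fin 2) ℂ) |
        ¬ PlaqSmall (θ (K - j)) (Averaging.iter (fun i => BlockAveraging.blockAvg (P := F.P K) (j := i) ℰp) j U)} ∩
      {U | ∀ i, i < j → PlaqSmall (θ (K - i))
          (Averaging.iter (fun i' => BlockAveraging.blockAvg (P := F.P K) (j := i') ℰp) i U)}) ≤
      Fintype.card (Plaq (F.P K) j) * B := by
  refine (measureReal_mono (finestBad_subset_iUnion_noWindow F θ K j) (measure_ne_top _ _)).trans ?_
  refine (measureReal_iUnion_fintype_le _).trans ?_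
  calc ∑ p : Plaq (F.P K) j, μ.real
        {U | (∀ k, k < j → PlaqSmall (θ (K - k))
            (Averaging.iter (fun i => BlockAveraging.blockAvg (P := F.P K) (j := i) ℰp) k U)) ∧
          θ (K - j) ≤ GaugeGroup.dist1 (GaugeField.plaqHol
            (Averaging.iter (fun i => BlockAveraging.blockAvg (P := F.P K) (j := i) ℰp) j U) p)}
      ≤ ∑ _p : Plaq (F.P K) j, B := Finset.sum_le_sum fun p _ => hFE p
    _ = Fintype.card (Plaq (F.P K) j) * B := by rw [Finset.sum_const, Finset.card_univ, nsmul_eq_mul]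

end Union

/-! ## §2 Crux r3 from summable per-family unit-top first-exit profiles -/

section Glue

/-- ★ **r3 ⇐ `UnitTopSummable`** (THE WEAKEST REGISTERED STUB OF THE LINE).  If for every block size `L` there are a profile `(b₀, p₀)` (`0 < b₀`, `2 < p₀`)
and a threshold `γ₁ ∈ (0, 1]` such that EVERY family `F` of block size `L` at EVERY coupling `0 < γ ≤ γ₁` has a non-negative profile `q` with
`Σ_d (L^d)³·q d < ∞` bounding, for EVERY depth `d` and UNIFORMLY IN THE RUN LENGTH `K ≥ 2`, the Gibbs mass (family `F.refine d`, coupling `γL^{-d}`,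
run `K`) of the unit-top first-exit event «every sub-unit block field `Ū^k`, `k < K`, is `θ_{b₀}(K−k)`-small ∧ `θ_{b₀}(0) ≤ |Ū^K(∂p) − 1|» of every unit
plaquette `p`, then crux r3 `LargeFieldMassRefinementTail` (stmt-QuantumFields-22884) holds.  Proof: on the ONE family `G = F.refine n₀` (`n₀` the least
depth with `γL^{-n₀} ≤ min(γ₁, γ_window, γ_one)`) the finest-bad-level masses at height `j ≥ 2` and co-height `d` are `≤ 9·8L^{3m_G}(L^d)³·q d` (§1 and the
level shift `gibbsK_real_firstExit_eq_refine`), at height `1` they are `≤ A'·2^{-d}` (landed `stub_firstExitOne` + window + per-height arithmetic), the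
bare masses follow `bareTailAt`; `refine_real_compl_histGood_le` sums them with `d` free top steps.  Conditional certificate: the hypothesis is NOT
proved here (it is the registered stub of skeleton v7); nothing about the mass gap. [cite: Balaban1985UV3, (7) p.257 and (70)-(71) p.273] -/
theorem largeFieldMassRefinementTail_of_unitTopSummable
    (hS : ∀ L : ℕ, ∃ (b₀ p₀ γ₁ : ℝ), 0 < b₀ ∧ 2 < p₀ ∧ 0 < γ₁ ∧ γ₁ ≤ 1 ∧ ∀ (F : T3Family) (γ : ℝ), F.L = L → 0 < γ → γ ≤ γ₁ →
      ∃ q : ℕ → ℝ, (∀ d, 0 ≤ q d) ∧ Summable (fun d : ℕ => ((F.L : ℝ) ^ d) ^ 3 * q d) ∧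
        ∀ (d K : ℕ), 2 ≤ K → ∀ p : Plaq ((F.refine d).P K) K,
          (gibbsK (F.refine d) ℰp (γ * ((F.L : ℝ)⁻¹) ^ d) K).real
              {V | (∀ k, k < K → PlaqSmall (θBal F.L (γ * ((F.L : ℝ)⁻¹) ^ d) b₀ p₀ (K - k))
                  (Averaging.iter (fun i => BlockAveraging.blockAvg (P := (F.refine d).P K) (j := i) ℰp) k V)) ∧
                θBal F.L (γ * ((F.L : ℝ)⁻¹) ^ d) b₀ p₀ 0 ≤ GaugeGroup.dist1 (GaugeField.plaqHol
                  (Averaging.iter (fun i => BlockAveraging.blockAvg (P := (F.refine d).P K) (j := i) ℰp) K V) p)} ≤ q d) :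
    Summit.QuantumFields.YangMills.Theses.SmallFieldWidening.LargeFieldMassRefinementTail := by
  classical
  intro L
  obtain ⟨b₀, p₀, γS, hb₀, hp₀, hγS, hγS1, hS⟩ := hS L
  have hp₀1 : 1 ≤ p₀ := by linarith
  -- the landed window and first averaged level (uniform in the family)
  obtain ⟨b₂, γW, hb₂, hγW, hγW1, hwin⟩ := firstExitWindow_oneStepWindowL_proof L b₀ p₀ hb₀ hp₀
  obtain ⟨γ₁, C₁, c₁, N₁, hγ₁, hγ₁1, hc₁, hC₁, h1⟩ := FirstExitWindow.stub_firstExitOne L b₀ p₀ b₂ hb₀ hp₀ hb₂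
  refine ⟨b₀, p₀, min γS (min γW γ₁), hb₀, hp₀, lt_min hγS (lt_min hγW hγ₁), fun F γ hFL hγ => ?_⟩
  have hL0 : (0 : ℝ) < F.L := by exact_mod_cast (zero_lt_one.trans F.hL.2)
  have hL1 : (1 : ℝ) ≤ F.L := by exact_mod_cast F.hL.2.le
  have hq1 : ((F.L : ℝ)⁻¹) ≤ 1 := inv_le_one_of_one_le₀ hL1
  have hq0 : (0 : ℝ) ≤ ((F.L : ℝ)⁻¹) := inv_nonneg.mpr hL0.le
  by_cases hex : ∃ n : ℕ, γ * ((F.L : ℝ)⁻¹) ^ n ≤ min γS (min γW γ₁)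
  · -- the working depth `n₀` = least admissible depth, the ONE family `G = F.refine n₀` at `γ' = γL^{-n₀} ≤ 1`
    set n₀ : ℕ := Nat.find hex with hn₀def
    set γ' : ℝ := γ * ((F.L : ℝ)⁻¹) ^ n₀ with hγ'def
    have hγ' : 0 < γ' := mul_pos hγ (pow_pos (inv_pos.mpr hL0) _)
    have hγ'le : γ' ≤ min γS (min γW γ₁) := Nat.find_spec hex
    have hγ'S : γ' ≤ γS := hγ'le.trans (min_le_left _ _)
    have hγ'W : γ' ≤ γW := hγ'le.trans ((min_le_right _ _).trans (min_le_left _ _))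
    have hγ'1' : γ' ≤ γ₁ := hγ'le.trans ((min_le_right _ _).trans (min_le_right _ _))
    have hγ'1 : γ' ≤ 1 := hγ'S.trans hγS1
    set G : T3Family := F.refine n₀ with hGdef
    have hGL : G.L = L := hFL
    have hGL1 : 1 ≤ G.L := le_of_lt G.hL.2
    have hGF : (G.L : ℝ) = F.L := by rw [show G.L = F.L from rfl]
    -- the family's summable unit-top profile at `γ'`
    obtain ⟨q, hq0', hqsum, hUT⟩ := hS G γ' hGL hγ' hγ'S
    -- the height-one profile constant
    obtain ⟨A', hA'0, hP⟩ := exists_perHeight_bound G hγ' hγ'1 hb₀ hp₀1 hC₁ N₁ hc₁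
    -- the finest-bad-level profile of `G`: height one (geometric) plus heights `≥ 2` (the family's `q` times the plaquette count)
    set qfb : ℕ → ℝ := fun i => A' * ((1 : ℝ) / 2) ^ i + (9 * (8 * (G.L : ℝ) ^ (3 * G.m))) * (((G.L : ℝ) ^ i) ^ 3 * q i)
      with hqfbdef
    have hvol0 : 0 ≤ 9 * (8 * (G.L : ℝ) ^ (3 * G.m)) := by positivity
    have hqfb0 : ∀ i, 0 ≤ qfb i := fun i =>
      add_nonneg (mul_nonneg hA'0 (pow_nonneg (by norm_num) i))
        (mul_nonneg hvol0 (mul_nonneg (pow_nonneg (pow_nonneg (Nat.cast_nonneg _) i) 3) (hq0' i)))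
    have hqfb : Summable qfb := by
      have h1s : Summable (fun i : ℕ => A' * ((1 : ℝ) / 2) ^ i) := (geometric_profile hA'0).2.1
      have h2s : Summable (fun i : ℕ => (9 * (8 * (G.L : ℝ) ^ (3 * G.m))) * (((G.L : ℝ) ^ i) ^ 3 * q i)) :=
        hqsum.mul_left _
      exact h1s.add h2s
    -- the finest-bad-level masses of `G` at every height `j ≥ 1`
    have hfb : ∀ K j : ℕ, 1 ≤ j → j ≤ K → (gibbsK G ℰp γ' K).real
        ({U | ¬ PlaqSmall (θBal G.L γ' b₀ p₀ (K - j))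
            (Averaging.iter (fun i => BlockAveraging.blockAvg (P := G.P K) (j := i) ℰp) j U)} ∩
          {U | ∀ i, i < j → PlaqSmall (θBal G.L γ' b₀ p₀ (K - i))
            (Averaging.iter (fun i' => BlockAveraging.blockAvg (P := G.P K) (j := i') ℰp) i U)}) ≤ qfb (K - j) := by
      intro K j hj1 hjK
      haveI := isProbabilityMeasure_gibbsK G ℰp hγ'.le K
      rcases Nat.lt_or_ge j 2 with hj | hj
      · -- `j = 1`: the landed first averaged level through the window, then the per-height arithmetic
        obtain rfl : j = 1 := by omega
        have hK : 0 + 1 ≤ K := by omega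
        have hB : ∀ p : Plaq (G.P K) (0 + 1), (gibbsK G ℰp γ' K).real
            {U | (∀ k, k < 0 + 1 → PlaqSmall (θBal G.L γ' b₀ p₀ (K - k))
                (Averaging.iter (fun i => BlockAveraging.blockAvg (P := G.P K) (j := i) ℰp) k U)) ∧
              PlaqSmall (θBal G.L γ' b₂ p₀ (K - (0 + 1)))
                (Averaging.iter (fun i => BlockAveraging.blockAvg (P := G.P K) (j := i) ℰp) (0 + 1) U) ∧
              θBal G.L γ' b₀ p₀ (K - (0 + 1)) ≤ GaugeGroup.dist1 (GaugeField.plaqHol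
                (Averaging.iter (fun i => BlockAveraging.blockAvg (P := G.P K) (j := i) ℰp) (0 + 1) U) p)} ≤
            C₁ * (G.scheme ℰp γ').β (K - (0 + 1)) ^ N₁ *
              Real.exp (-(c₁ * B10.pFun b₀ p₀ (Real.sqrt (γ' * ((G.L : ℝ)⁻¹) ^ (K - (0 + 1)))) ^ 2)) := by
          intro p
          refine (h1 G γ' hGL hγ' hγ'1' K hK p).trans ?_
          show C₁ * (G.scheme ℰp γ').β (K - (0 + 1)) ^ N₁ *
              Real.exp (-(c₁ * B10.pFun b₀ p₀ (Real.sqrt (γ' * ((G.L : ℝ)⁻¹) ^ (K - (0 + 1)))) ^ 2)) ≤ _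
          exact le_rfl
        have hE0 : 0 ≤ C₁ * (G.scheme ℰp γ').β (K - (0 + 1)) ^ N₁ *
            Real.exp (-(c₁ * B10.pFun b₀ p₀ (Real.sqrt (γ' * ((G.L : ℝ)⁻¹) ^ (K - (0 + 1)))) ^ 2)) :=
          mul_nonneg (mul_nonneg hC₁ (pow_nonneg (G.scheme_β_nonneg ℰp hγ'.le (K - (0 + 1))) N₁)) (Real.exp_nonneg _)
        have hub := real_finestBad_le_card_mul G γ' b₀ b₂ p₀ (gibbsK G ℰp γ' K) (hwin G γ' hGL hγ' hγ'W K 0 hK) hB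
        refine hub.trans ?_
        refine ((mul_le_mul_of_nonneg_right (card_plaq_le_pow G hK) hE0).trans (hP (K - (0 + 1)))).trans ?_
        show A' * ((1 : ℝ) / 2) ^ (K - 1) ≤ qfb (K - 1)
        rw [hqfbdef]
        exact le_add_of_nonneg_right
          (mul_nonneg hvol0 (mul_nonneg (pow_nonneg (pow_nonneg (Nat.cast_nonneg _) _) 3) (hq0' _)))
      · -- `j ≥ 2`: the window-free union bound, each first-exit event read as a unit-top event of `G.refine (K - j)`
        obtain ⟨d, rfl⟩ := Nat.exists_eq_add_of_le hjK
        have hd : j + d - j = d := Nat.add_sub_cancel_left j d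
        have hB : ∀ p : Plaq (G.P (j + d)) j, (gibbsK G ℰp γ' (j + d)).real
            {U | (∀ k, k < j → PlaqSmall (θBal G.L γ' b₀ p₀ (j + d - k))
                (Averaging.iter (fun i => BlockAveraging.blockAvg (P := G.P (j + d)) (j := i) ℰp) k U)) ∧
              θBal G.L γ' b₀ p₀ (j + d - j) ≤ GaugeGroup.dist1 (GaugeField.plaqHol
                (Averaging.iter (fun i => BlockAveraging.blockAvg (P := G.P (j + d)) (j := i) ℰp) j U) p)} ≤ q d := by
          intro p
          rw [hd, gibbsK_real_firstExit_eq_refine G γ' hγ'.le b₀ p₀ d j p]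
          exact hUT d j hj _
        refine (real_finestBad_le_card_mul_noWindow G (θBal G.L γ' b₀ p₀) (j + d) j (gibbsK G ℰp γ' (j + d)) hB).trans ?_
        refine (mul_le_mul_of_nonneg_right (card_plaq_le_pow G (Nat.le_add_right j d)) (hq0' d)).trans ?_
        rw [hd]
        show 9 * (8 * (G.L : ℝ) ^ (3 * G.m) * ((G.L : ℝ) ^ d) ^ 3) * q d ≤ qfb d
        rw [hqfbdef]
        have : 9 * (8 * (G.L : ℝ) ^ (3 * G.m) * ((G.L : ℝ) ^ d) ^ 3) * q d =
            (9 * (8 * (G.L : ℝ) ^ (3 * G.m))) * (((G.L : ℝ) ^ d) ^ 3 * q d) := by ring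
        rw [this]
        exact le_add_of_nonneg_left (mul_nonneg hA'0 (pow_nonneg (by norm_num) d))
    -- the bare profile of the ONE family `G`
    obtain ⟨q₀, hq₀0, hq₀, -, hbare⟩ := bareTailAt G hγ' hγ'1 hb₀ hp₀1
    -- the null sequence: `1` below the working depth, the two tail sums from it on
    refine ⟨fun n => (if n < n₀ then (1 : ℝ) else 0) + ((∑' t, q₀ (t + (n - n₀))) + ∑' t, qfb (t + (n - n₀))), ?_,
      fun n K hle => ?_⟩
    · have h0 := (tendsto_sum_nat_add q₀).comp (tendsto_sub_atTop_nat n₀)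
      have h1' := (tendsto_sum_nat_add qfb).comp (tendsto_sub_atTop_nat n₀)
      have hind : Tendsto (fun n : ℕ => if n < n₀ then (1 : ℝ) else 0) atTop (𝓝 0) := by
        refine tendsto_const_nhds.congr' ?_
        filter_upwards [eventually_ge_atTop n₀] with n hn
        rw [if_neg (not_lt.mpr hn)]
      have h := hind.add (h0.add h1')
      simpa using h
    · haveI := isProbabilityMeasure_gibbsK (F.refine n) ℰp (mul_nonneg hγ.le (pow_nonneg hq0 n)) K
      have htails : 0 ≤ (∑' t, q₀ (t + (n - n₀))) + ∑' t, qfb (t + (n - n₀)) :=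
        add_nonneg (tsum_nonneg fun t => hq₀0 _) (tsum_nonneg fun t => hqfb0 _)
      beta_reduce
      by_cases hn : n < n₀
      · -- finitely many shallow depths: the trivial bound
        rw [if_pos hn]
        exact (measureReal_le_one).trans (le_add_of_nonneg_right htails)
      · rw [if_neg hn, zero_add]
        obtain ⟨d, rfl⟩ : ∃ d, n = n₀ + d := ⟨n - n₀, by omega⟩
        have hdd : n₀ + d - n₀ = d := Nat.add_sub_cancel_left _ _
        have hc' : γ * ((F.L : ℝ)⁻¹) ^ (n₀ + d) = γ' * ((F.L : ℝ)⁻¹) ^ d := by rw [pow_add, hγ'def, mul_assoc]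
        rw [hdd]
        have hGr : F.refine (n₀ + d) = G.refine d := (refine_refine F n₀ d).symm
        -- move to the family `G` and its run `K` at depth `d`
        have goal := refine_real_compl_histGood_le G hγ'.le b₀ p₀ hqfb0 hqfb hbare hfb d K
        rw [← hGr, hGF, ← hc'] at goal
        refine goal.trans ?_
        have h1'' : q₀ (K + d) ≤ ∑' t, q₀ (t + d) := by
          have := ((summable_nat_add_iff d).mpr hq₀).sum_le_tsum {K} (fun t _ => hq₀0 (t + d))
          simpa using this
        exact add_le_add h1'' le_rfl
  · exact ⟨fun _ => 0, tendsto_const_nhds, fun n K hle => (hex ⟨n, hle⟩).elim⟩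

end Glue


end Summit.QuantumFields.YangMills.Theorems.LargeFieldMassRefinementTailOfSummableUnitTop

end
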